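import Literature.Computability.QuantumComplexity.HadamardGadgetCompiler
import Literature.Computability.QuantumComplexity.CliffordTInverse
import Literature.Computability.QuantumComplexity.ControlledHadamard
import Literature.Computability.Cryptography.QubitRegisterCzProofs
import Literature.Computability.Cryptography.QubitRegisterPauliZProofs
import Literature.Computability.QuantumComplexity.OneQubitReflections
import Literature.Computability.QuantumComplexity.BoykinGates
import HarnessLib

/-!
# The Hadamard-gadget compiler simulates the given circuit (BJS Theorem 1, proof)

Topic `Literature/Computability/QuantumComplexity`; third file of the `HGadget.Hop` line of the discharge
of the named fact `PostBQPWith_subset_PostIQPWith` (`PostBQPToPostIQP.lean`), after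
`HadamardGadgetStates.lean` (the state calculus) and `HadamardGadgetCompiler.lean` (the compiled circuit
`gadgetCircuit C`; see its header for the relation to the other line `HadamardGadget.lean` /
`HadamardGadgetIQP.lean` / `HadamardGadgetFamily.lean`, whose names this line avoids: its family file is
`HadamardGadgetHopFamily.lean`). Source:
M. J. Bremner, R. Jozsa, D. J. Shepherd, Proc. R. Soc. A 467 (2011) = arXiv:1005.1407, proof of
Thm. 1 (p. 7): the compiled post-selected IQP circuit has "the same output conditional
probabilities as originally (now conditioned on the new extra post-selections too)".

Contents (all proved):

* the generic induction step `project_step` (spent wires, their final Hadamards and their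
  post-selection can be pushed through the later diagonal gates) and the **two-hop block**
  `twoHop_embedState` (a block "phase, hop, phase, hop, phase" moves the logical register two stages
  on and applies `δ₂ H^{⊗N} δ₁ H^{⊗N} δ₀` to the logical state);
* the logical meaning of the blocks: `microSem`, with `S H S H S = ω H` (`sHsHs_eq`),
  `H₁ Z₁ H₁ = X₁`, `H_d CZ_{cd} H_d = CNOT_{cd}`, so that the blocks of the micro-operations of a
  Clifford+T gate apply the gate up to a power of `ω = e^{iπ/4}` (`microListSem_microOps`), and the
  blocks of a whole oracle-free circuit apply its matrix (`microListSem_microList`);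
* the invariant along the compiled circuit (`reaches_blocksN`, `reaches_gadget`) and the **simulation
  theorem** `HGadget.Hop.gadget_eventSum_eq`: for `N = n + m ≥ 2` and every `b`, the Born weight of the
  event "input wires and post-selection block read `0…0`, output wire `n` reads `b`" in
  `H^{⊗W} · gadgetCircuit C · H^{⊗W} |x 0…0⟩` is `gadgetConst C` times the Born weight of
  "wire `1` reads `1`, wire `0` reads `b`" in `C |x 0^m⟩`, with `0 < gadgetConst C` independent of
  `x` and `b`.

## References

* M. J. Bremner, R. Jozsa, D. J. Shepherd, Proc. R. Soc. A 467 (2011) 459–472, arXiv:1005.1407,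
  Thm. 1 and its proof (p. 7, Fig. 1).
* M. A. Nielsen, I. L. Chuang, *Quantum Computation and Quantum Information*, CUP 2010, §4.2,
  Ex. 4.17 (`CNOT = H CZ H`), §2.2.5 (Born rule).
-/

noncomputable section

namespace Literature.Computability.QuantumComplexity

open Matrix Cryptography Finset

namespace HGadget.Hop

open BGK (hLayerMatrix hLayerMatrix_empty)

variable {W N : ℕ}

/-! ### Commutations in vector form -/

/-- A Hadamard layer and a diagonal operator ignoring its wires commute (vector form). [folklore] -/
theorem hLayerMatrix_mulVec_diagonal_mulVec (S : Finset (Fin W)) {d : QReg W → ℂ}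
    (hd : ∀ x y : QReg W, (∀ i, i ∉ S → x i = y i) → d x = d y) (v : QReg W → ℂ) :
    hLayerMatrix S *ᵥ (diagonal d *ᵥ v) = diagonal d *ᵥ (hLayerMatrix S *ᵥ v) := by
  rw [mulVec_mulVec, mulVec_mulVec, hLayerMatrix_mul_diagonal_comm S hd]

/-- The projector and a Hadamard layer on other wires commute (vector form). [folklore] -/
theorem zeroProj_mulVec_hLayerMatrix_mulVec {S T : Finset (Fin W)} (h : Disjoint S T) (v : QReg W → ℂ) :
    zeroProj S *ᵥ (hLayerMatrix T *ᵥ v) = hLayerMatrix T *ᵥ (zeroProj S *ᵥ v) := by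
  rw [mulVec_mulVec, mulVec_mulVec, zeroProj_mul_hLayerMatrix_comm h]

/-- The projector and a diagonal operator commute (vector form). [folklore] -/
theorem zeroProj_mulVec_diagonal_mulVec (S : Finset (Fin W)) (d : QReg W → ℂ) (v : QReg W → ℂ) :
    zeroProj S *ᵥ (diagonal d *ᵥ v) = diagonal d *ᵥ (zeroProj S *ᵥ v) := by
  rw [mulVec_mulVec, mulVec_mulVec, zeroProj_mul_diagonal_comm]

/-- Two projectors commute (vector form). [folklore] -/
theorem zeroProj_mulVec_comm (S T : Finset (Fin W)) (v : QReg W → ℂ) :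
    zeroProj S *ᵥ (zeroProj T *ᵥ v) = zeroProj T *ᵥ (zeroProj S *ᵥ v) := by
  rw [mulVec_mulVec, mulVec_mulVec, ← zeroProj_union, ← zeroProj_union, Finset.union_comm]

/-- Splitting a diagonal operator (vector form). [folklore] -/
theorem diagonal_mul_mulVec (d₁ d₂ : QReg W → ℂ) (v : QReg W → ℂ) :
    diagonal (fun z => d₁ z * d₂ z) *ᵥ v = diagonal d₁ *ᵥ (diagonal d₂ *ᵥ v) := by
  rw [mulVec_mulVec, diagonal_mul_diagonal]

/-- The projector on no wire is the identity. [folklore] -/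
theorem zeroProj_empty : zeroProj (∅ : Finset (Fin W)) = 1 := by
  rw [zeroProj, ← diagonal_one]
  congr 1; funext z; simp [zeroOn_empty]

/-! ### The generic induction step -/

/-- **Induction step.** If the spent wires `S`, their final Hadamards and their post-selection turn
the state `diag(d₁) V` into `E`, then after a further diagonal phase `d₂` not involving `S` and with
further spent wires `S₂` disjoint from `S`, the state is obtained from `E` by `d₂`, the Hadamards on
`S₂` and the post-selection of `S₂`: the history of `S` can be collapsed first.
[cite: BremnerJozsaShepherdPRSA2011, Thm. 1 (proof: "performing this replacement for every intermediate H gate")] -/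
theorem project_step {V E : QReg W → ℂ} {S S₂ : Finset (Fin W)} {d₁ d₂ : QReg W → ℂ}
    (h₁ : zeroProj S *ᵥ (hLayerMatrix S *ᵥ (diagonal d₁ *ᵥ V)) = E)
    (hd₂ : ∀ x y : QReg W, (∀ i, i ∉ S → x i = y i) → d₂ x = d₂ y) (hdisj : Disjoint S S₂) :
    zeroProj (S ∪ S₂) *ᵥ (hLayerMatrix (S ∪ S₂) *ᵥ (diagonal (fun z => d₁ z * d₂ z) *ᵥ V)) =
      zeroProj S₂ *ᵥ (hLayerMatrix S₂ *ᵥ (diagonal d₂ *ᵥ E)) := by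
  rw [← h₁, Finset.union_comm, zeroProj_union, hLayerMatrix_union hdisj.symm,
    show (fun z => d₁ z * d₂ z) = fun z => d₂ z * d₁ z from funext fun z => mul_comm _ _,
    diagonal_mul_mulVec, ← mulVec_mulVec, ← mulVec_mulVec,
    hLayerMatrix_mulVec_diagonal_mulVec S hd₂, zeroProj_mulVec_hLayerMatrix_mulVec hdisj,
    zeroProj_mulVec_diagonal_mulVec S d₂]

/-! ### The two-hop block -/

/-- A phase read off the wires of `p` ignores every set of wires avoiding `p`. [folklore] -/
theorem comp_ignores {k : ℕ} (p : Fin k ↪ Fin W) (S : Finset (Fin W)) (hp : ∀ j, p j ∉ S)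
    (δ : QReg k → ℂ) : ∀ x y : QReg W, (∀ i, i ∉ S → x i = y i) → δ (x ∘ p) = δ (y ∘ p) :=
  fun _ _ h => congrArg δ (funext fun j => h (p j) (hp j))

/-- Membership in the image of an embedding avoiding a range. [folklore] -/
theorem not_mem_map_of_not_mem_range {k k' : ℕ} {p : Fin k ↪ Fin W} {q : Fin k' ↪ Fin W}
    (h : ∀ j, q j ∉ Set.range p) (j : Fin k') : q j ∉ Finset.univ.map p := by
  rw [Finset.mem_map]; rintro ⟨i, -, hi⟩; exact h j ⟨i, hi⟩

/-- **The two-hop block.** Let the logical state `φ` sit on the wires `p₀` with spent wires `S`, and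
let `p₁`, `p₂` be fresh positions (pairwise disjoint, off `S`). The phase
`δ₀(z|_{p₀}) χ_{p₀p₁}(z) δ₁(z|_{p₁}) χ_{p₁p₂}(z) δ₂(z|_{p₂})` (logical phases interleaved with the two
hop layers), followed by the final Hadamards and the post-selections of the wires `p₀`, `p₁`, yields
the logical state `δ₂ · H^{⊗N}(δ₁ · H^{⊗N}(δ₀ · φ))` on the wires `p₂` — two Hadamard gadgets per line.
[cite: BremnerJozsaShepherdPRSA2011, Thm. 1 (proof, Fig. 1)] -/
theorem twoHop_embedState (p₀ p₁ p₂ : Fin N ↪ Fin W) {S : Finset (Fin W)}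
    (h0S : ∀ j, p₀ j ∉ S) (h1S : ∀ j, p₁ j ∉ S)
    (h01 : ∀ j, p₁ j ∉ Set.range p₀) (h12 : ∀ j, p₂ j ∉ Set.range p₁) (h02 : ∀ j, p₂ j ∉ Set.range p₀)
    (δ₀ δ₁ δ₂ φ : QReg N → ℂ) :
    zeroProj (Finset.univ.map p₀ ∪ Finset.univ.map p₁) *ᵥ
        (hLayerMatrix (Finset.univ.map p₀ ∪ Finset.univ.map p₁) *ᵥ
          (diagonal (fun z => δ₀ (z ∘ p₀) * czLayerPhase p₀ p₁ z * δ₁ (z ∘ p₁) *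
              czLayerPhase p₁ p₂ z * δ₂ (z ∘ p₂)) *ᵥ embedState p₀ S φ)) =
      embedState p₂ (S ∪ Finset.univ.map p₀ ∪ Finset.univ.map p₁)
        (fun y => δ₂ y * (hGateAll N *ᵥ fun y' => δ₁ y' * (hGateAll N *ᵥ fun y'' => δ₀ y'' * φ y'') y') y) := by
  set P₀ := Finset.univ.map p₀ with hP₀
  set P₁ := Finset.univ.map p₁ with hP₁
  have hdisj : Disjoint P₀ P₁ := by
    rw [Finset.disjoint_right]; intro w hw1 hw0
    obtain ⟨j, -, rfl⟩ := Finset.mem_map.1 hw1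
    exact not_mem_map_of_not_mem_range h01 j hw0
  have hp1P0 : ∀ j, p₁ j ∉ P₀ := not_mem_map_of_not_mem_range h01
  have hp2P0 : ∀ j, p₂ j ∉ P₀ := not_mem_map_of_not_mem_range h02
  have hp2P1 : ∀ j, p₂ j ∉ P₁ := not_mem_map_of_not_mem_range h12
  -- regroup the phase as `d₂' · (e₁ · e₀)`
  have hsplit : (fun z => δ₀ (z ∘ p₀) * czLayerPhase p₀ p₁ z * δ₁ (z ∘ p₁) * czLayerPhase p₁ p₂ z * δ₂ (z ∘ p₂)) =
      fun z => δ₂ (z ∘ p₂) * ((czLayerPhase p₁ p₂ z * δ₁ (z ∘ p₁)) * (czLayerPhase p₀ p₁ z * δ₀ (z ∘ p₀))) := by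
    funext z; ring
  have hd2 : ∀ x y : QReg W, (∀ i, i ∉ P₀ → x i = y i) → δ₂ (x ∘ p₂) = δ₂ (y ∘ p₂) := comp_ignores p₂ P₀ hp2P0 δ₂
  have hd2' : ∀ x y : QReg W, (∀ i, i ∉ P₁ → x i = y i) → δ₂ (x ∘ p₂) = δ₂ (y ∘ p₂) := comp_ignores p₂ P₁ hp2P1 δ₂
  have he1 : ∀ x y : QReg W, (∀ i, i ∉ P₀ → x i = y i) →
      czLayerPhase p₁ p₂ x * δ₁ (x ∘ p₁) = czLayerPhase p₁ p₂ y * δ₁ (y ∘ p₁) := by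
    intro x y h
    rw [comp_ignores p₁ P₀ hp1P0 δ₁ x y h, czLayerPhase_congr p₁ p₂ (fun j => ⟨h _ (hp1P0 j), h _ (hp2P0 j)⟩)]
  rw [hsplit, zeroProj_union, Finset.union_comm P₀ P₁, hLayerMatrix_union hdisj.symm, diagonal_mul_mulVec,
    diagonal_mul_mulVec]
  simp only [← mulVec_mulVec]
  -- push `hLayerMatrix P₀` inside past the two outer diagonals
  rw [hLayerMatrix_mulVec_diagonal_mulVec P₀ hd2, hLayerMatrix_mulVec_diagonal_mulVec P₀ he1]
  -- push `zeroProj P₀` inside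
  rw [zeroProj_mulVec_comm P₀ P₁, zeroProj_mulVec_hLayerMatrix_mulVec hdisj, zeroProj_mulVec_diagonal_mulVec P₀,
    zeroProj_mulVec_diagonal_mulVec P₀]
  -- first hop
  rw [diagonal_mul_mulVec (czLayerPhase p₀ p₁) (fun z => δ₀ (z ∘ p₀)),
    diagonal_mulVec_embedState p₀ S (d' := δ₀) (fun z _ => rfl), hopLayer_embedState p₀ p₁ h0S h01]
  -- push `hLayerMatrix P₁`, `zeroProj P₁` past `δ₂`
  rw [hLayerMatrix_mulVec_diagonal_mulVec P₁ hd2', zeroProj_mulVec_diagonal_mulVec]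
  -- second hop
  have h1S' : ∀ j, p₁ j ∉ S ∪ P₀ := fun j h => by
    rcases Finset.mem_union.1 h with h | h
    exacts [h1S j h, hp1P0 j h]
  rw [diagonal_mul_mulVec (czLayerPhase p₁ p₂) (fun z => δ₁ (z ∘ p₁)),
    diagonal_mulVec_embedState p₁ (S ∪ P₀) (d' := δ₁) (fun z _ => rfl), hopLayer_embedState p₁ p₂ h1S' h12,
    diagonal_mulVec_embedState p₂ (S ∪ P₀ ∪ P₁) (d' := δ₂) (fun z _ => rfl)]

/-! ### One-qubit identities -/

/-- Scalars times `mk2`. [folklore] -/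
theorem smul_mk2 (c a b c' d : ℂ) : c • mk2 a b c' d = mk2 (c * a) (c * b) (c * c') (c * d) := by
  ext x y
  simp only [Matrix.smul_apply, mk2_apply, smul_eq_mul]
  split_ifs <;> rfl

/-- **`S H S H S = ω H`** (`ω = e^{iπ/4}`): the Hadamard gate from two Hadamards and three phase
gates — how the compiler realises an `H` on a line that must hop twice. [cite: NielsenChuang2010, §4.2 (H, S, T)] -/
theorem sGate_hGate_sGate_hGate_sGate : sGate * hGate * sGate * hGate * sGate = omega • hGate := by
  rw [sGate_eq_mk2, hGate_eq_mk2, mk2_mul_mk2, mk2_mul_mk2, mk2_mul_mk2, mk2_mul_mk2, smul_mk2, omega_eq]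
  have hI : Complex.I ^ 2 = -1 := Complex.I_sq
  congr 1
  · ring
  · linear_combination (-(invSqrt2 : ℂ) ^ 2) * hI
  · linear_combination (-(invSqrt2 : ℂ) ^ 2) * hI
  · linear_combination ((invSqrt2 : ℂ) ^ 2 * (1 + Complex.I)) * hI

/-- The Pauli `X` gate by entries. [cite: NielsenChuang2010, §1.3.1] -/
theorem pauliX_eq_mk2 : pauliX = mk2 0 1 1 0 := by
  ext x y
  rw [mk2_apply]
  rcases Bool.eq_false_or_eq_true (x 0) with hx | hx <;>
  rcases Bool.eq_false_or_eq_true (y 0) with hy | hy <;> simp [pauliX, hx, hy]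

-- `H Z H = X` is `OneQubit.hGate_mul_pauliZ_mul_hGate` (OneQubitReflections.lean).

/-- `H^{⊗1} = H`. [cite: NielsenChuang2010, §1.4.4] -/
theorem hGateAll_one : hGateAll 1 = hGate := by
  ext x y; exact hGateAll_one_apply x y

/-- Scalars pass through placement. [folklore] -/
theorem placeGate_smul {k : ℕ} (e : Fin k ↪ Fin N) (c : ℂ) (U : Matrix (QReg k) (QReg k) ℂ) :
    placeGate e (c • U) = c • placeGate e U := by
  ext x y
  simp only [placeGate_apply, Matrix.smul_apply, smul_eq_mul]
  split_ifs <;> simp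

/-! ### Logical phases as placed gates -/

/-- `diag(ω^{y_a})` is `T` on qubit `a`. [cite: NielsenChuang2010, §4.2] -/
theorem diagonal_tPh (a : Fin N) : diagonal (tPh a) = placeGate (wireEmb a) tGate := by
  rw [tGate_eq_diagonal_omega, placeGate_diagonal]; rfl

/-- `sGate = diag(1, ω²)`. [cite: NielsenChuang2010, §4.2 (S = T²)] -/
theorem sGate_eq_diagonal_omega_mul : sGate = diagonal fun x : QReg 1 => (if x 0 = true then omega else 1) * (if x 0 = true then omega else 1) := by
  ext x y
  rw [sGate, Matrix.of_apply, Matrix.diagonal_apply]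
  by_cases hxy : x = y
  · rw [if_pos hxy, if_pos hxy]
    rcases Bool.eq_false_or_eq_true (x 0) with hx | hx
    · simp [hx, ← omega_pow_two, sq]
    · simp [hx]
  · rw [if_neg hxy, if_neg hxy]

/-- `diag(ω^{2 y_a})` is `S` on qubit `a`. [cite: NielsenChuang2010, §4.2 (S = T²)] -/
theorem diagonal_sPh (a : Fin N) : diagonal (sPh a) = placeGate (wireEmb a) sGate := by
  rw [sGate_eq_diagonal_omega_mul, placeGate_diagonal]; rfl

/-- `diag((-1)^{y_a y_b})` is `CZ` on qubits `a ≠ b`. [cite: NielsenChuang2010, §4.2] -/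
theorem diagonal_czPh (a b : Fin N) (h : a ≠ b) : diagonal (czPh a b) = placeGate (pairEmb a b h) cz := by
  rw [cz_eq_diagonal, placeGate_diagonal]
  congr 1; funext y
  simp only [czPh, Function.comp_apply, pairEmb_zero, pairEmb_one, Bool.and_eq_true]
  by_cases hh : (y a = true ∧ y b = true) <;> simp [hh]

/-- The all-one phase is the identity. [folklore] -/
theorem diagonal_const_one : diagonal (fun _ : QReg N => (1 : ℂ)) = 1 := diagonal_one

/-- **`S_a H^{⊗N} S_a H^{⊗N} S_a = ω H_a`** on `N` qubits: on qubit `a` this is `S H S H S = ω H`, on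
the others `H H = 1`. [cite: NielsenChuang2010, §4.2] -/
theorem sHsHs_eq (a : Fin N) :
    placeGate (wireEmb a) sGate * hGateAll N * placeGate (wireEmb a) sGate * hGateAll N * placeGate (wireEmb a) sGate =
      omega • placeGate (wireEmb a) hGate := by
  have hdisj := disjoint_range_complWireEmb (wireEmb a)
  have hRS : ∀ X : Matrix (QReg N) (QReg N) ℂ,
      X * placeGate (complWireEmb (wireEmb a)) (hGateAll _) * placeGate (wireEmb a) sGate =
        X * placeGate (wireEmb a) sGate * placeGate (complWireEmb (wireEmb a)) (hGateAll _) := by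
    intro X; rw [mul_assoc, mul_assoc, placeGate_comm_of_disjoint_holds _ _ hdisj]
  have hRH : ∀ X : Matrix (QReg N) (QReg N) ℂ,
      X * placeGate (complWireEmb (wireEmb a)) (hGateAll _) * placeGate (wireEmb a) (hGateAll 1) =
        X * placeGate (wireEmb a) (hGateAll 1) * placeGate (complWireEmb (wireEmb a)) (hGateAll _) := by
    intro X; rw [mul_assoc, mul_assoc, placeGate_comm_of_disjoint_holds _ _ hdisj]
  have hRR : ∀ X : Matrix (QReg N) (QReg N) ℂ,
      X * placeGate (complWireEmb (wireEmb a)) (hGateAll _) * placeGate (complWireEmb (wireEmb a)) (hGateAll _) = X := by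
    intro X; rw [mul_assoc, ← placeGate_mul_holds, hGateAll_mul_self, placeGate_one, mul_one]
  rw [hGateAll_eq_placeGate_mul_placeGate (wireEmb a)]
  simp only [← mul_assoc]
  simp only [hRS, hRH, hRR]
  rw [← placeGate_mul_holds, ← placeGate_mul_holds, ← placeGate_mul_holds, ← placeGate_mul_holds, hGateAll_one,
    sGate_hGate_sGate_hGate_sGate, placeGate_smul]

/-- **`H_a Z_a H_a = X_a`** on `N` qubits (with `H^{⊗N}` on both sides: the other Hadamards cancel).
[cite: NielsenChuang2010, §4.2 (Ex. 4.13)] -/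
theorem hZh_eq (a : Fin N) :
    hGateAll N * placeGate (wireEmb a) pauliZ * hGateAll N = placeGate (wireEmb a) pauliX := by
  have hdisj := disjoint_range_complWireEmb (wireEmb a)
  have hRZ : ∀ X : Matrix (QReg N) (QReg N) ℂ,
      X * placeGate (complWireEmb (wireEmb a)) (hGateAll _) * placeGate (wireEmb a) pauliZ =
        X * placeGate (wireEmb a) pauliZ * placeGate (complWireEmb (wireEmb a)) (hGateAll _) := by
    intro X; rw [mul_assoc, mul_assoc, placeGate_comm_of_disjoint_holds _ _ hdisj]
  have hRH : ∀ X : Matrix (QReg N) (QReg N) ℂ,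
      X * placeGate (complWireEmb (wireEmb a)) (hGateAll _) * placeGate (wireEmb a) (hGateAll 1) =
        X * placeGate (wireEmb a) (hGateAll 1) * placeGate (complWireEmb (wireEmb a)) (hGateAll _) := by
    intro X; rw [mul_assoc, mul_assoc, placeGate_comm_of_disjoint_holds _ _ hdisj]
  have hRR : ∀ X : Matrix (QReg N) (QReg N) ℂ,
      X * placeGate (complWireEmb (wireEmb a)) (hGateAll _) * placeGate (complWireEmb (wireEmb a)) (hGateAll _) = X := by
    intro X; rw [mul_assoc, ← placeGate_mul_holds, hGateAll_mul_self, placeGate_one, mul_one]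
  rw [hGateAll_eq_placeGate_mul_placeGate (wireEmb a)]
  simp only [← mul_assoc]
  simp only [hRZ, hRH, hRR]
  rw [← placeGate_mul_holds, ← placeGate_mul_holds, hGateAll_one, OneQubit.hGate_mul_pauliZ_mul_hGate]

/-- **`H_d CZ_{cd} H_d = CNOT_{cd}`** on `N` qubits (from the tree's `czWord`: `H_d CNOT_{cd} H_d = CZ_{cd}`).
[cite: NielsenChuang2010, §4.3 Ex. 4.17] -/
theorem hCZh_eq_cnot (c d : Fin N) (h : c ≠ d) :
    placeGate (wireEmb d) hGate * placeGate (pairEmb c d h) cz * placeGate (wireEmb d) hGate =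
      placeGate (pairEmb c d h) cnot := by
  -- the word `H_d CNOT H_d` is the diagonal `CZ` phase
  have hword : (hOn d).toMatrix 0 * (cnotOn c d h).toMatrix 0 * (hOn d).toMatrix 0 = placeGate (pairEmb c d h) cz := by
    have hm : (⟨czWord c d h⟩ : QCircuit cliffordT N).toMatrix 0 =
        (hOn d).toMatrix 0 * (cnotOn c d h).toMatrix 0 * (hOn d).toMatrix 0 := by
      rw [czWord, QCircuit.toMatrix_cons, QCircuit.toMatrix_cons, QCircuit.toMatrix_cons, QCircuit.toMatrix_nil,
        Matrix.one_mul, mul_assoc]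
    rw [← hm, ← diagonal_czPh c d h]
    ext x y
    have hcol := congrFun (czWord_mulVec_basisState (0 : Language Bool) c d h y) x
    rw [mulVec_basisState] at hcol
    simp only [Pi.smul_apply, basisState_apply, smul_eq_mul] at hcol
    rw [hcol, Matrix.diagonal_apply, czPh]
    by_cases hxy : x = y
    · subst hxy; simp
    · rw [if_neg hxy, if_neg hxy, mul_zero]
  rw [← hword, hOn_toMatrix, cnotOn_toMatrix]
  have hHH : placeGate (wireEmb d) hGate * placeGate (wireEmb d) hGate = (1 : Matrix (QReg N) (QReg N) ℂ) := by
    rw [← placeGate_mul_holds, hGate_mul_hGate, placeGate_one]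
  rw [show placeGate (wireEmb d) hGate * (placeGate (wireEmb d) hGate * placeGate (pairEmb c d h) cnot *
      placeGate (wireEmb d) hGate) * placeGate (wireEmb d) hGate =
      (placeGate (wireEmb d) hGate * placeGate (wireEmb d) hGate) * placeGate (pairEmb c d h) cnot *
        (placeGate (wireEmb d) hGate * placeGate (wireEmb d) hGate) by simp only [mul_assoc],
    hHH, one_mul, mul_one]

/-! ### The logical maps of the blocks -/

/-- **The logical map of the block of a micro-operation**: `δ₂ · H^{⊗N}(δ₁ · H^{⊗N}(δ₀ · φ))`.
[cite: BremnerJozsaShepherdPRSA2011, Thm. 1 (proof)] -/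
def microSem (op : MicroOp N) (φ : QReg N → ℂ) : QReg N → ℂ :=
  fun y => microδ₂ op y * (hGateAll N *ᵥ fun y' => microδ₁ op y' *
    (hGateAll N *ᵥ fun y'' => microδ₀ op y'' * φ y'') y') y

/-- The block matrix `diag(δ₂) H^{⊗N} diag(δ₁) H^{⊗N} diag(δ₀)`. [folklore] -/
def microMat (op : MicroOp N) : Matrix (QReg N) (QReg N) ℂ :=
  diagonal (microδ₂ op) * hGateAll N * diagonal (microδ₁ op) * hGateAll N * diagonal (microδ₀ op)

/-- `microSem` is multiplication by `microMat`. [folklore] -/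
theorem microSem_eq_mulVec (op : MicroOp N) (φ : QReg N → ℂ) : microSem op φ = microMat op *ᵥ φ := by
  rw [microMat]
  simp only [← mulVec_mulVec]
  funext y
  rw [microSem, mulVec_diagonal]
  congr 1
  congr 1; funext y'
  rw [mulVec_diagonal]
  congr 1
  congr 1; funext y''
  rw [mulVec_diagonal]

/-- The block of `T_a` applies `T_a`. [cite: NielsenChuang2010, §4.2] -/
theorem microMat_T (a : Fin N) : microMat (.T a) = placeGate (wireEmb a) tGate := by
  simp only [microMat, microδ₀, microδ₁, microδ₂, diagonal_const_one, one_mul, mul_one, hGateAll_mul_self, diagonal_tPh]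

/-- The block of `S_a` applies `S_a`. [cite: NielsenChuang2010, §4.2] -/
theorem microMat_S (a : Fin N) : microMat (.S a) = placeGate (wireEmb a) sGate := by
  simp only [microMat, microδ₀, microδ₁, microδ₂, diagonal_const_one, one_mul, mul_one, hGateAll_mul_self, diagonal_sPh]

/-- The block of `CZ_{ab}` applies `CZ_{ab}`. [cite: NielsenChuang2010, §4.2] -/
theorem microMat_CZ (a b : Fin N) (h : a ≠ b) : microMat (.CZ a b h) = placeGate (pairEmb a b h) cz := by
  simp only [microMat, microδ₀, microδ₁, microδ₂, diagonal_const_one, one_mul, mul_one, hGateAll_mul_self, diagonal_czPh a b h]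

/-- The block of `H_a` applies `ω H_a`. [cite: NielsenChuang2010, §4.2] -/
theorem microMat_H (a : Fin N) : microMat (.H a) = omega • placeGate (wireEmb a) hGate := by
  simp only [microMat, microδ₀, microδ₁, microδ₂, diagonal_sPh, sHsHs_eq]

/-- The logical map of a list of micro-operations (blocks in order). [cite: BremnerJozsaShepherdPRSA2011, Thm. 1 (proof)] -/
def microListSem : List (MicroOp N) → (QReg N → ℂ) → QReg N → ℂ
  | [], φ => φ
  | op :: ops, φ => microListSem ops (microSem op φ)

/-- `microListSem` of a concatenation. [folklore] -/
theorem microListSem_append (ops ops' : List (MicroOp N)) (φ : QReg N → ℂ) :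
    microListSem (ops ++ ops') φ = microListSem ops' (microListSem ops φ) := by
  induction ops generalizing φ with
  | nil => rfl
  | cons op ops ih => exact ih _

/-- `microSem` is linear (scalars). [folklore] -/
theorem microSem_smul (op : MicroOp N) (c : ℂ) (φ : QReg N → ℂ) : microSem op (c • φ) = c • microSem op φ := by
  rw [microSem_eq_mulVec, microSem_eq_mulVec, mulVec_smul]

/-- `microListSem` is linear (scalars). [folklore] -/
theorem microListSem_smul (ops : List (MicroOp N)) (c : ℂ) (φ : QReg N → ℂ) :
    microListSem ops (c • φ) = c • microListSem ops φ := by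
  induction ops generalizing φ with
  | nil => rfl
  | cons op ops ih => rw [microListSem, microListSem, microSem_smul, ih]

/-- The number of phases `ω` picked up by the micro-operations of a gate (`1` per `H`, `2` per
`CNOT`). [folklore] -/
def omegaCount : QGate cliffordT N → ℕ
  | .gate .H _ => 1
  | .gate .CNOT _ => 2
  | _ => 0

/-- **The blocks of the micro-operations of an oracle-free Clifford+T gate apply the gate**, up to
`ω^{omegaCount}`. [cite: BremnerJozsaShepherdPRSA2011, Thm. 1 (proof)] -/
theorem microListSem_microOps {g : QGate cliffordT N} (hg : g.IsOracleFree) (φ : QReg N → ℂ) :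
    microListSem (microOps g) φ = omega ^ omegaCount g • (g.toMatrix 0 *ᵥ φ) := by
  cases g with
  | oracle k e => exact absurd hg id
  | gate op e =>
    cases op with
    | H =>
      simp only [microOps, microListSem, microSem_eq_mulVec, microMat_H, omegaCount, pow_one, smul_mulVec,
        gateH_eq_hOn e, hOn_toMatrix]
    | S =>
      simp only [microOps, microListSem, microSem_eq_mulVec, microMat_S, omegaCount, pow_zero, one_smul,
        gateS_eq_sOn e, sOn_toMatrix]
    | T =>
      simp only [microOps, microListSem, microSem_eq_mulVec, microMat_T, omegaCount, pow_zero, one_smul]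
      rw [← emb_one_eq_wireEmb (embT e)]; rfl
    | CNOT =>
      simp only [microOps, microListSem, microSem_eq_mulVec, microMat_H, microMat_CZ, omegaCount,
        gateCNOT_eq_cnotOn e, cnotOn_toMatrix]
      rw [mulVec_mulVec, mulVec_mulVec, smul_mul_assoc, smul_mul_assoc, mul_smul_comm, smul_smul,
        hCZh_eq_cnot, smul_mulVec, sq]

/-- `microList` of a cons. [folklore] -/
theorem microList_cons (g : QGate cliffordT N) (gs : List (QGate cliffordT N)) :
    microList (⟨g :: gs⟩ : QCircuit cliffordT N) = microOps g ++ microList ⟨gs⟩ := rfl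

/-- The total `ω`-count of a gate list. [folklore] -/
def omegaCountList (gs : List (QGate cliffordT N)) : ℕ := (gs.map omegaCount).sum

/-- **The blocks of an oracle-free circuit apply its matrix** (up to a power of `ω`).
[cite: BremnerJozsaShepherdPRSA2011, Thm. 1 (proof: "the same output conditional probabilities as originally")] -/
theorem microListSem_microList {gs : List (QGate cliffordT N)} (h : ∀ g ∈ gs, g.IsOracleFree) (φ : QReg N → ℂ) :
    microListSem (microList ⟨gs⟩) φ = omega ^ omegaCountList gs • ((⟨gs⟩ : QCircuit cliffordT N).mat *ᵥ φ) := by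
  induction gs generalizing φ with
  | nil => simp [microList, microListSem, omegaCountList, QCircuit.mat]
  | cons g gs ih =>
    rw [microList_cons, microListSem_append, microListSem_microOps (h g (by simp)), microListSem_smul,
      ih (fun g' hg' => h g' (by simp [hg']))]
    simp only [QCircuit.mat, QCircuit.toMatrix_cons, ← mulVec_mulVec, smul_smul, ← pow_add, omegaCountList,
      List.map_cons, List.sum_cons]

/-! ### The invariant along the compiled circuit -/

section invariant

variable {n m : ℕ} (C : QCircuit cliffordT (n + m))

/-- `Reaches C V d S pos φ`: after the diagonal phase `d`, the final Hadamards of the spent wires `S`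
and their post-selection, the state `V` has become the logical state `φ` on the wires `pos`.
[cite: BremnerJozsaShepherdPRSA2011, Thm. 1 (proof)] -/
def Reaches (V : QReg (width C) → ℂ) (d : QReg (width C) → ℂ) (S : Finset (Fin (width C)))
    (pos : Fin (n + m) ↪ Fin (width C)) (φ : QReg (n + m) → ℂ) : Prop :=
  zeroProj S *ᵥ (hLayerMatrix S *ᵥ (diagonal d *ᵥ V)) = embedState pos S φ

/-- Wires of a stage `s' ≥ 1` are outside every set of wires low at a stage `s ≤ s'`. [folklore] -/
theorem stageEmb_not_mem_of_low {S : Finset (Fin (width C))} {s : ℕ} (hlow : ∀ w ∈ S, LowWire n m s w)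
    {s' : ℕ} (hs' : s' ≤ finalStage C + 1) (h1 : 1 ≤ s') (hss : s ≤ s') (j : Fin (n + m)) :
    stageEmb C s' hs' j ∉ S := fun h =>
  not_lowWire_posNat (n := n) (m := m) (i := j) s h1 hss (hlow _ h)

/-- Wires of distinct stages are distinct (embedding form). [folklore] -/
theorem stageEmb_not_mem_range {s s' : ℕ} (hs : s ≤ finalStage C + 1) (hs' : s' ≤ finalStage C + 1)
    (hne : s ≠ s') (j : Fin (n + m)) : stageEmb C s' hs' j ∉ Set.range (stageEmb C s hs) := by
  rintro ⟨i, hi⟩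
  have hv := congrArg Fin.val hi
  simp only [stageEmb_val] at hv
  rcases lt_or_gt_of_ne hne with h | h
  · exact posNat_ne_of_lt i.2 h hv
  · exact posNat_ne_of_lt j.2 h hv.symm

/-- Wires of stage `2` are not home wires. [folklore] -/
theorem stageEmb_two_not_mem_range_home (h2 : 2 ≤ finalStage C + 1) (j : Fin (n + m)) :
    stageEmb C 2 h2 j ∉ Set.range (homeEmb C) := by
  rintro ⟨i, hi⟩
  have hv := congrArg Fin.val hi
  simp only [stageEmb_val, homeEmb_val, homeNat] at hv
  split_ifs at hv with h
  · have := mul_le_posNat (n + m) 2 j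
    have := n_succ_lt_stride (n := n) (m := m)
    omega
  · exact posNat_ne_of_lt i.2 (by norm_num : 1 < 2) hv

/-- Final targets are not wires of stage `s_f`. [folklore] -/
theorem finalEmb_not_mem_range_stage (j : Fin (n + m)) :
    finalEmb C j ∉ Set.range (stageEmb C (finalStage C) (Nat.le_succ _)) := by
  rintro ⟨i, hi⟩
  have hv := congrArg Fin.val hi
  simp only [stageEmb_val, finalEmb_val, finalTgt] at hv
  have h1 := n_succ_lt_stride (n := n) (m := m)
  have h2 : stride (n + m) * 1 ≤ stride (n + m) * finalStage C := Nat.mul_le_mul_left _ (by unfold finalStage; omega)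
  have h3 := mul_le_posNat (n + m) (finalStage C) i
  split_ifs at hv
  · omega
  · omega
  · exact posNat_ne_of_lt i.2 (Nat.lt_succ_self _) hv

/-- Final targets are outside every set of wires low at stage `s_f + 1`. [folklore] -/
theorem finalEmb_not_mem_of_low {S : Finset (Fin (width C))} (hlow : ∀ w ∈ S, LowWire n m (finalStage C + 1) w)
    (j : Fin (n + m)) : finalEmb C j ∉ S := by
  intro h
  have hl := hlow _ h
  have hv : ((finalEmb C j : Fin (width C)) : ℕ) = finalTgt n m (finalStage C) j := rfl
  rw [hv] at hl
  unfold finalTgt at hl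
  split_ifs at hl
  · exact (not_lowWire_n (n := n) (m := m) (finalStage C + 1)).1 hl
  · exact (not_lowWire_n (n := n) (m := m) (finalStage C + 1)).2 hl
  · exact not_lowWire_posNat (n := n) (m := m) (finalStage C + 1) (by omega) le_rfl hl

/-- The set of wires spent by the block at stage `s`: the wires of stages `s` and `s + 1`. [folklore] -/
def blockSpent (s : ℕ) (h0 : s ≤ finalStage C + 1) (h1 : s + 1 ≤ finalStage C + 1) : Finset (Fin (width C)) :=
  Finset.univ.map (stageEmb C s h0) ∪ Finset.univ.map (stageEmb C (s + 1) h1)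

/-- The block at stage `s` spends `2N` wires. [folklore] -/
theorem card_blockSpent (s : ℕ) (h0 : s ≤ finalStage C + 1) (h1 : s + 1 ≤ finalStage C + 1) :
    (blockSpent C s h0 h1).card = 2 * (n + m) := by
  rw [blockSpent, Finset.card_union_of_disjoint, Finset.card_map, Finset.card_map, Finset.card_univ, Fintype.card_fin,
    two_mul]
  rw [Finset.disjoint_right]; intro w hw1 hw0
  obtain ⟨j, -, rfl⟩ := Finset.mem_map.1 hw1
  obtain ⟨i, -, hi⟩ := Finset.mem_map.1 hw0
  exact stageEmb_not_mem_range C h0 h1 (by omega) j ⟨i, hi⟩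

/-- **One block.** From stage `s ≥ 1` with spent wires low at `s`, the block of a micro-operation takes
the register to stage `s + 2` in the logical state `microSem op φ`, spending the wires of stages `s`,
`s + 1` (disjoint from the old ones), all low at `s + 2`. [cite: BremnerJozsaShepherdPRSA2011, Thm. 1 (proof)] -/
theorem reaches_blockN {S : Finset (Fin (width C))} {s : ℕ} (h1 : 1 ≤ s) (h2 : s + 2 ≤ finalStage C + 1)
    (hlow : ∀ w ∈ S, LowWire n m s w) (op : MicroOp (n + m)) :
    (∀ (V d : QReg (width C) → ℂ) (φ : QReg (n + m) → ℂ), Reaches C V d S (stageEmb C s (by omega)) φ →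
      Reaches C V (fun z => d z * listPhase (blockN (n + m) s op) z) (S ∪ blockSpent C s (by omega) (by omega))
        (stageEmb C (s + 2) h2) (microSem op φ)) ∧
    (∀ w ∈ S ∪ blockSpent C s (by omega) (by omega), LowWire n m (s + 2) w) ∧
    Disjoint S (blockSpent C s (by omega) (by omega)) := by
  have h0 : s ≤ finalStage C + 1 := by omega
  have h1' : s + 1 ≤ finalStage C + 1 := by omega
  set p₀ := stageEmb C s h0
  set p₁ := stageEmb C (s + 1) h1'
  set p₂ := stageEmb C (s + 2) h2
  have h0S : ∀ j, p₀ j ∉ S := stageEmb_not_mem_of_low C hlow h0 h1 le_rfl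
  have h1S : ∀ j, p₁ j ∉ S := stageEmb_not_mem_of_low C hlow h1' (by omega) (by omega)
  have h2S : ∀ j, p₂ j ∉ S := stageEmb_not_mem_of_low C hlow h2 (by omega) (by omega)
  have h01 : ∀ j, p₁ j ∉ Set.range p₀ := stageEmb_not_mem_range C h0 h1' (by omega)
  have h12 : ∀ j, p₂ j ∉ Set.range p₁ := stageEmb_not_mem_range C h1' h2 (by omega)
  have h02 : ∀ j, p₂ j ∉ Set.range p₀ := stageEmb_not_mem_range C h0 h2 (by omega)
  have hdisj : Disjoint S (Finset.univ.map p₀ ∪ Finset.univ.map p₁) := by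
    rw [Finset.disjoint_right]
    intro w hw hwS
    rcases Finset.mem_union.1 hw with hw | hw <;> obtain ⟨j, -, rfl⟩ := Finset.mem_map.1 hw
    exacts [h0S j hwS, h1S j hwS]
  refine ⟨?_, ?_, hdisj⟩
  · intro V d φ hR
    -- the phase of the block ignores `S`
    have hd₂ : ∀ x y : QReg (width C), (∀ i, i ∉ S → x i = y i) →
        listPhase (blockN (n + m) s op) x = listPhase (blockN (n + m) s op) y := by
      intro x y hxy
      rw [listPhase_blockN C s h0 h1' h2, listPhase_blockN C s h0 h1' h2,
        comp_ignores p₀ S h0S (microδ₀ op) x y hxy, comp_ignores p₁ S h1S (microδ₁ op) x y hxy,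
        comp_ignores p₂ S h2S (microδ₂ op) x y hxy,
        czLayerPhase_congr p₀ p₁ (fun j => ⟨hxy _ (h0S j), hxy _ (h1S j)⟩),
        czLayerPhase_congr p₁ p₂ (fun j => ⟨hxy _ (h1S j), hxy _ (h2S j)⟩)]
    unfold Reaches
    rw [blockSpent, project_step hR hd₂ hdisj, show (listPhase (blockN (n + m) s op) : QReg (width C) → ℂ) = _ from
      funext (listPhase_blockN C s h0 h1' h2 op), twoHop_embedState p₀ p₁ p₂ h0S h1S h01 h12 h02, Finset.union_assoc]
    rfl
  · intro w hw
    rcases Finset.mem_union.1 hw with hw | hw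
    · exact (hlow w hw).mono (by omega)
    · rcases Finset.mem_union.1 hw with hw | hw <;> obtain ⟨j, -, rfl⟩ := Finset.mem_map.1 hw
      · exact lowWire_posNat h1 (by omega) j.2
      · exact lowWire_posNat (by omega) (by omega) j.2

/-- **All blocks** from stage `s`: the register reaches stage `s + 2 · #ops` in the logical state
`microListSem ops φ`, with a set of spent wires (independent of the state) low at that stage and of
size `|S| + 2N · #ops`. [cite: BremnerJozsaShepherdPRSA2011, Thm. 1 (proof)] -/
theorem reaches_blocksN (ops : List (MicroOp (n + m))) :
    ∀ (s : ℕ) (h1 : 1 ≤ s) (hs : s + 2 * ops.length ≤ finalStage C + 1)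
      (S : Finset (Fin (width C))) (_ : ∀ w ∈ S, LowWire n m s w),
      ∃ S' : Finset (Fin (width C)), (∀ w ∈ S', LowWire n m (s + 2 * ops.length) w) ∧
        S'.card = S.card + 2 * (n + m) * ops.length ∧
        ∀ (V d : QReg (width C) → ℂ) (φ : QReg (n + m) → ℂ), Reaches C V d S (stageEmb C s (by omega)) φ →
          Reaches C V (fun z => d z * listPhase (blocksN (n + m) s ops) z) S'
            (stageEmb C (s + 2 * ops.length) hs) (microListSem ops φ) := by
  induction ops with
  | nil =>
    intro s h1 hs S hlow
    refine ⟨S, by simpa using hlow, by simp, ?_⟩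
    intro V d φ hR
    have hd : (fun z => d z * listPhase (blocksN (n + m) s ([] : List (MicroOp (n + m)))) z) = d := by
      funext z; simp [blocksN]
    rw [hd]; exact hR
  | cons op ops ih =>
    intro s h1 hs S hlow
    have h2 : s + 2 ≤ finalStage C + 1 := by simp only [List.length_cons] at hs; omega
    obtain ⟨hR', hlow', hdisj⟩ := reaches_blockN C h1 h2 hlow op
    have hs' : s + 2 + 2 * ops.length ≤ finalStage C + 1 := by simp only [List.length_cons] at hs; omega
    obtain ⟨S', hlowS', hcard, hRS'⟩ := ih (s + 2) (by omega) hs' _ hlow'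
    have heq : s + 2 + 2 * ops.length = s + 2 * (op :: ops).length := by simp only [List.length_cons]; ring
    refine ⟨S', fun w hw => heq ▸ hlowS' w hw, ?_, ?_⟩
    · rw [hcard, Finset.card_union_of_disjoint hdisj, card_blockSpent, List.length_cons]; ring
    · intro V d φ hR
      have key : ∀ (t t' : ℕ) (ht : t ≤ finalStage C + 1) (ht' : t' ≤ finalStage C + 1) (_ : t = t'),
          Reaches C V (fun z => d z * listPhase (blockN (n + m) s op) z * listPhase (blocksN (n + m) (s + 2) ops) z) S'
            (stageEmb C t ht) (microListSem ops (microSem op φ)) →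
          Reaches C V (fun z => d z * listPhase (blocksN (n + m) s (op :: ops)) z) S'
            (stageEmb C t' ht') (microListSem (op :: ops) φ) := by
        rintro t t' ht ht' rfl h
        simpa only [blocksN, listPhase_append, mul_assoc, microListSem] using h
      exact key _ _ hs' hs heq (hRS' V _ _ (hR' V d φ hR))

variable (x : QReg n)

/-- The input register of the compiled circuit: `|x 0…0⟩`. [folklore] -/
abbrev inputReg : QReg (width C) := padInput x (ancillas n m C)

/-- Values of a padded input. [folklore] -/
theorem padInput_apply' {n M : ℕ} (x : QReg n) (i : Fin (n + M)) :
    padInput x M i = if h : (i : ℕ) < n then x ⟨i, h⟩ else false := by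
  unfold padInput
  by_cases h : (i : ℕ) < n
  · rw [dif_pos h]
    have : i = Fin.castAdd M ⟨i, h⟩ := Fin.ext rfl
    conv_lhs => rw [this]
    exact Fin.append_left _ _ _
  · rw [dif_neg h]
    have : i = Fin.natAdd n ⟨i - n, by omega⟩ := Fin.ext (by simp; omega)
    conv_lhs => rw [this]
    exact Fin.append_right _ _ _

/-- The input register vanishes off the home wires. [folklore] -/
theorem inputReg_eq_false_of_not_mem_range (w : Fin (width C)) (hw : w ∉ Set.range (homeEmb C)) :
    inputReg C x w = false := by
  rw [inputReg, padInput_apply']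
  split_ifs with h
  · exact absurd ⟨⟨w, by omega⟩, Fin.ext (by simp [homeNat, h])⟩ hw
  · rfl

/-- The input register restricted to the home wires is the logical input. [folklore] -/
theorem inputReg_comp_homeEmb : inputReg C x ∘ homeEmb C = padInput x m := by
  funext j
  simp only [Function.comp_apply, inputReg, padInput_apply']
  have hv : ((homeEmb C j : Fin (width C)) : ℕ) = homeNat n m j := rfl
  by_cases h : (j : ℕ) < n
  · have hv' : ((homeEmb C j : Fin (width C)) : ℕ) = j := by rw [hv, homeNat, if_pos h]
    rw [dif_pos (by rw [hv']; exact h), dif_pos h]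
    congr 1; exact Fin.ext hv'
  · have hv' : ¬ ((homeEmb C j : Fin (width C)) : ℕ) < n := by
      rw [hv, homeNat, if_neg h]; have := mul_le_posNat (n + m) 1 j; have := n_succ_lt_stride (n := n) (m := m); omega
    rw [dif_neg hv', dif_neg h]

/-- The state after the initial Hadamards. [folklore] -/
abbrev initState : QReg (width C) → ℂ := hGateAll (width C) *ᵥ basisState (inputReg C x)

/-- The logical state at the start: `(1/√2)^{W-N} H^{⊗N} |x 0^m⟩` on the home wires. [folklore] -/
abbrev φ₀ : QReg (n + m) → ℂ :=
  (((Real.sqrt 2 : ℂ)⁻¹) ^ (width C - (n + m))) • (hGateAll (n + m) *ᵥ basisState (padInput x m))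

/-- **Start of the invariant**: nothing spent, logical state `φ₀` at home. [cite: BremnerJozsaShepherdPRSA2011, §2.3] -/
theorem reaches_start : Reaches C (initState C x) (fun _ => 1) ∅ (homeEmb C) (φ₀ C x) := by
  rw [Reaches, diagonal_const_one, one_mulVec, hLayerMatrix_empty, one_mulVec, zeroProj_empty, one_mulVec, initState,
    hGateAll_mulVec_basisState_eq_embedState (homeEmb C) _ (inputReg_eq_false_of_not_mem_range C x),
    inputReg_comp_homeEmb]

/-- **After the initial layer**: the home wires are spent and the logical state `(1/√2)^{W-N} |x 0^m⟩`
sits at stage `2`. [cite: BremnerJozsaShepherdPRSA2011, Thm. 1 (proof)] -/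
theorem reaches_init (h2 : 2 ≤ finalStage C + 1) :
    Reaches C (initState C x) (fun z => 1 * listPhase (initN n m) z) (∅ ∪ Finset.univ.map (homeEmb C))
      (stageEmb C 2 h2) ((((Real.sqrt 2 : ℂ)⁻¹) ^ (width C - (n + m))) • basisState (padInput x m)) := by
  have hstep := project_step (reaches_start C x) (S₂ := Finset.univ.map (homeEmb C)) (d₂ := listPhase (initN n m))
    (fun x y hxy => by rw [funext fun i => hxy i (Finset.notMem_empty i)]) (Finset.disjoint_empty_left _)
  rw [Reaches, hstep, show (listPhase (initN n m) : QReg (width C) → ℂ) = _ from funext (listPhase_initN C h2),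
    hopLayer_embedState (homeEmb C) (stageEmb C 2 h2) (fun j h => Finset.notMem_empty _ h)
    (stageEmb_two_not_mem_range_home C h2), φ₀, mulVec_smul, mulVec_mulVec, hGateAll_mul_self, one_mulVec]

/-- The home wires are low at stage `2`. [folklore] -/
theorem low_home : ∀ w ∈ (∅ ∪ Finset.univ.map (homeEmb C) : Finset (Fin (width C))), LowWire n m 2 w := by
  intro w hw
  rw [Finset.empty_union] at hw
  obtain ⟨j, -, rfl⟩ := Finset.mem_map.1 hw
  exact lowWire_homeNat j.2

/-- The `Z` phase of logical qubit `1` (for `N ≥ 2`). [cite: BremnerJozsaShepherdPRSA2011, Thm. 1 (proof)] -/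
def zPh (hN : 2 ≤ n + m) (y : QReg (n + m)) : ℂ := if y ⟨1, hN⟩ = true then -1 else 1

/-- The final embedding sends qubit `1` to the wire `n + 1`. [folklore] -/
theorem finalEmb_one (hN : 2 ≤ n + m) : finalEmb C ⟨1, hN⟩ = ⟨n + 1, n_succ_lt_width C⟩ :=
  Fin.ext (by simp [finalTgt])

/-- The final embedding sends qubit `0` to the output wire `n`. [folklore] -/
theorem finalEmb_zero (hN : 2 ≤ n + m) : finalEmb C ⟨0, by omega⟩ = ⟨n, by have := n_succ_lt_width C; omega⟩ :=
  Fin.ext (by simp [finalTgt])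

/-- **The final layer**: from stage `s_f` with spent wires low at `s_f`, the register reaches the final
embedding in the logical state `Z₁ H^{⊗N} φ`. [cite: BremnerJozsaShepherdPRSA2011, Thm. 1 (proof) and Def. 3] -/
theorem reaches_final (hN : 2 ≤ n + m) {V d : QReg (width C) → ℂ} {S : Finset (Fin (width C))}
    (hlow : ∀ w ∈ S, LowWire n m (finalStage C) w) {φ : QReg (n + m) → ℂ}
    (hR : Reaches C V d S (stageEmb C (finalStage C) (Nat.le_succ _)) φ) :
    Reaches C V (fun z => d z * listPhase (finalN n m (finalStage C)) z)
      (S ∪ Finset.univ.map (stageEmb C (finalStage C) (Nat.le_succ _))) (finalEmb C)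
      (fun y => zPh hN y * (hGateAll (n + m) *ᵥ φ) y) ∧
    (∀ w ∈ S ∪ Finset.univ.map (stageEmb C (finalStage C) (Nat.le_succ _)), LowWire n m (finalStage C + 1) w) ∧
    Disjoint S (Finset.univ.map (stageEmb C (finalStage C) (Nat.le_succ _))) := by
  set p := stageEmb C (finalStage C) (Nat.le_succ _)
  have hsf1 : 1 ≤ finalStage C := by unfold finalStage; omega
  have hpS : ∀ j, p j ∉ S := stageEmb_not_mem_of_low C hlow (Nat.le_succ _) hsf1 le_rfl
  have hlow' : ∀ w ∈ S ∪ Finset.univ.map p, LowWire n m (finalStage C + 1) w := by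
    intro w hw
    rcases Finset.mem_union.1 hw with hw | hw
    · exact (hlow w hw).mono (Nat.le_succ _)
    · obtain ⟨j, -, rfl⟩ := Finset.mem_map.1 hw
      exact lowWire_posNat hsf1 (Nat.lt_succ_self _) j.2
  have hdisj : Disjoint S (Finset.univ.map p) := by
    rw [Finset.disjoint_right]; intro w hw hwS
    obtain ⟨j, -, rfl⟩ := Finset.mem_map.1 hw
    exact hpS j hwS
  refine ⟨?_, hlow', hdisj⟩
  have hfS : ∀ j, finalEmb C j ∉ S := fun j h => finalEmb_not_mem_of_low C hlow' j (Finset.mem_union_left _ h)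
  have hfP : ∀ j, finalEmb C j ∉ Finset.univ.map p := fun j h =>
    finalEmb_not_mem_of_low C hlow' j (Finset.mem_union_right _ h)
  -- the `Z` phase on the wire `n + 1`, read through the final embedding
  have hz : ∀ z : QReg (width C), (if z ⟨n + 1, n_succ_lt_width C⟩ = true then (-1 : ℂ) else 1) = zPh hN (z ∘ finalEmb C) := by
    intro z; simp only [zPh, Function.comp_apply, finalEmb_one C hN]
  have hd₂ : ∀ x y : QReg (width C), (∀ i, i ∉ S → x i = y i) →
      listPhase (finalN n m (finalStage C)) x = listPhase (finalN n m (finalStage C)) y := by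
    intro x y hxy
    rw [listPhase_finalN, listPhase_finalN, hz, hz, czLayerPhase_congr p (finalEmb C) (fun j => ⟨hxy _ (hpS j), hxy _ (hfS j)⟩),
      comp_ignores (finalEmb C) S hfS (zPh hN) x y hxy]
  unfold Reaches
  rw [project_step hR hd₂ hdisj, show (listPhase (finalN n m (finalStage C)) : QReg (width C) → ℂ) =
      fun z => czLayerPhase p (finalEmb C) z * zPh hN (z ∘ finalEmb C) from funext fun z => by rw [listPhase_finalN, hz]]
  have hzig : ∀ x y : QReg (width C), (∀ i, i ∉ Finset.univ.map p → x i = y i) →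
      zPh hN (x ∘ finalEmb C) = zPh hN (y ∘ finalEmb C) := comp_ignores (finalEmb C) _ hfP (zPh hN)
  rw [show (fun z => czLayerPhase p (finalEmb C) z * zPh hN (z ∘ finalEmb C)) =
      fun z => zPh hN (z ∘ finalEmb C) * czLayerPhase p (finalEmb C) z from funext fun z => mul_comm _ _,
    diagonal_mul_mulVec, hLayerMatrix_mulVec_diagonal_mulVec _ hzig, zeroProj_mulVec_diagonal_mulVec,
    hopLayer_embedState p (finalEmb C) hpS (finalEmb_not_mem_range_stage C),
    diagonal_mulVec_embedState (finalEmb C) _ (d' := zPh hN) (fun z _ => rfl)]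

/-- **The whole compiled circuit**: there is a set `S` of spent wires — low at `s_f + 1`, of size
`N · s_f` (one per Hadamard gadget) — such that for every input `x`, starting from `H^{⊗W}|x 0…0⟩`, the
phase of `gadgetGates C`, the final Hadamards of `S` and its post-selection yield the logical state
`Z₁ H^{⊗N} (blocks ((1/√2)^{W-N} |x 0^m⟩))` on the final embedding.
[cite: BremnerJozsaShepherdPRSA2011, Thm. 1 (proof)] -/
theorem reaches_gadget (hN : 2 ≤ n + m) :
    ∃ S : Finset (Fin (width C)), (∀ w ∈ S, LowWire n m (finalStage C + 1) w) ∧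
      S.card = (n + m) * finalStage C ∧
      ∀ x : QReg n, Reaches C (initState C x) (listPhase (gadgetGates C)) S (finalEmb C)
        (fun y => zPh hN y * (hGateAll (n + m) *ᵥ microListSem (microList C)
          ((((Real.sqrt 2 : ℂ)⁻¹) ^ (width C - (n + m))) • basisState (padInput x m))) y) := by
  have h2 : 2 ≤ finalStage C + 1 := by unfold finalStage; omega
  have hsf : 2 + 2 * (microList C).length ≤ finalStage C + 1 := by unfold finalStage; omega
  obtain ⟨S₁, hlow₁, hcard₁, hR₁⟩ := reaches_blocksN C (microList C) 2 (by norm_num) hsf _ (low_home C)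
  have key : ∀ (t : ℕ) (ht : t ≤ finalStage C + 1) (_ : t = finalStage C) (S₁ : Finset (Fin (width C)))
      (_ : ∀ w ∈ S₁, LowWire n m t w) (_ : S₁.card + (n + m) = (n + m) * t)
      (_ : ∀ x : QReg n, Reaches C (initState C x)
        (fun z => 1 * listPhase (initN n m) z * listPhase (blocksN (n + m) 2 (microList C)) z) S₁ (stageEmb C t ht)
        (microListSem (microList C) ((((Real.sqrt 2 : ℂ)⁻¹) ^ (width C - (n + m))) • basisState (padInput x m)))),
      ∃ S : Finset (Fin (width C)), (∀ w ∈ S, LowWire n m (finalStage C + 1) w) ∧ S.card = (n + m) * finalStage C ∧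
        ∀ x : QReg n, Reaches C (initState C x)
          (fun z => 1 * listPhase (initN n m) z * listPhase (blocksN (n + m) 2 (microList C)) z *
            listPhase (finalN n m (finalStage C)) z) S (finalEmb C)
          (fun y => zPh hN y * (hGateAll (n + m) *ᵥ microListSem (microList C)
            ((((Real.sqrt 2 : ℂ)⁻¹) ^ (width C - (n + m))) • basisState (padInput x m))) y) := by
    rintro t ht rfl S₁ hlow hcard hR
    refine ⟨S₁ ∪ Finset.univ.map (stageEmb C (finalStage C) (Nat.le_succ _)), ?_, ?_, fun x => ?_⟩
    · obtain ⟨-, hlow', -⟩ := reaches_final C hN hlow (hR (fun _ => false))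
      exact hlow'
    · obtain ⟨-, -, hdisj⟩ := reaches_final C hN hlow (hR (fun _ => false))
      rw [Finset.card_union_of_disjoint hdisj, Finset.card_map, Finset.card_univ, Fintype.card_fin, hcard]
    · exact (reaches_final C hN hlow (hR x)).1
  have hcard₁' : S₁.card + (n + m) = (n + m) * (2 + 2 * (microList C).length) := by
    rw [hcard₁, Finset.empty_union, Finset.card_map, Finset.card_univ, Fintype.card_fin]; ring
  obtain ⟨S, hlowS, hcardS, hRS⟩ := key _ hsf (by unfold finalStage; ring) S₁ hlow₁ hcard₁'
    (fun x => hR₁ _ _ _ (reaches_init C x h2))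
  refine ⟨S, hlowS, hcardS, fun x => ?_⟩
  have hd : listPhase (gadgetGates C : List (QGate iqpDiag (width C))) =
      fun z => 1 * listPhase (initN n m) z * listPhase (blocksN (n + m) 2 (microList C)) z *
        listPhase (finalN n m (finalStage C)) z := by
    funext z; rw [gadgetGates, listPhase_append, listPhase_append, one_mul]
  rw [hd]
  exact hRS x

end invariant

/-! ### Read-out: the simulation theorem -/

section readout

variable {n m : ℕ} (C : QCircuit cliffordT (n + m))

/-- `n + postLen = 2^L (s_f + 1) + 1`. [folklore] -/
theorem n_add_postLen : n + postLen n m C = stride (n + m) * (finalStage C + 1) + 1 := by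
  unfold postLen
  have h1 := n_succ_lt_stride (n := n) (m := m)
  have h2 : stride (n + m) ≤ stride (n + m) * (finalStage C + 1) := Nat.le_mul_of_pos_right _ (by omega)
  omega

/-- **The wires of the final embedding**: `n`, `n + 1` and the ignored block from `2^L (s_f + 1) + 2` on.
[cite: BremnerJozsaShepherdPRSA2011, Def. 3 (output and post-selection registers)] -/
theorem mem_map_finalEmb_iff (hN : 2 ≤ n + m) (w : Fin (width C)) :
    w ∈ Finset.univ.map (finalEmb C) ↔
      ((w : ℕ) = n ∨ (w : ℕ) = n + 1 ∨ stride (n + m) * (finalStage C + 1) + 2 ≤ (w : ℕ)) := by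
  constructor
  · intro hw
    obtain ⟨i, -, rfl⟩ := Finset.mem_map.1 hw
    simp only [finalEmb_val, finalTgt]
    split_ifs with h0 h1
    · exact Or.inl rfl
    · exact Or.inr (Or.inl rfl)
    · right; right; unfold posNat; omega
  · intro hw
    have hwW : (w : ℕ) < stride (n + m) * (finalStage C + 1) + (n + m) := by rw [← width_eq]; exact w.2
    rcases hw with hw | hw | hw
    · refine Finset.mem_map.2 ⟨⟨0, by omega⟩, Finset.mem_univ _, Fin.ext ?_⟩
      rw [finalEmb_val]; simp [finalTgt, hw]
    · refine Finset.mem_map.2 ⟨⟨1, hN⟩, Finset.mem_univ _, Fin.ext ?_⟩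
      rw [finalEmb_val]; simp [finalTgt, hw]
    · refine Finset.mem_map.2 ⟨⟨(w : ℕ) - stride (n + m) * (finalStage C + 1), by omega⟩, Finset.mem_univ _, Fin.ext ?_⟩
      rw [finalEmb_val, finalTgt, if_neg (by simp; omega), if_neg (by simp; omega)]
      simp only [posNat]; omega

/-- **The post-selection event** of the compiled family on the register: the input wires `0, …, n-1`
and the block `n + 1, …, n + postLen` read `0`. [cite: BremnerJozsaShepherdPRSA2011, Def. 3] -/
def PostZero (z : QReg (width C)) : Prop :=
  ∀ w : Fin (width C), ((w : ℕ) < n ∨ (n + 1 ≤ (w : ℕ) ∧ (w : ℕ) ≤ n + postLen n m C)) → z w = false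

/-- `PostZero` is decidable. [folklore] -/
instance (z : QReg (width C)) : Decidable (PostZero C z) := by unfold PostZero; infer_instance

/-- **The post-selection event is "all non-final wires and the wire of qubit `1` read `0`"**.
[cite: BremnerJozsaShepherdPRSA2011, Def. 3] -/
theorem postZero_iff (hN : 2 ≤ n + m) (z : QReg (width C)) :
    PostZero C z ↔ ZeroOn (Finset.univ \ Finset.univ.map (finalEmb C)) z ∧ z (finalEmb C ⟨1, hN⟩) = false := by
  have hpl := n_add_postLen C
  have hst := n_succ_lt_stride (n := n) (m := m)
  have hcond : ∀ w : Fin (width C), ((w : ℕ) < n ∨ (n + 1 ≤ (w : ℕ) ∧ (w : ℕ) ≤ n + postLen n m C)) ↔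
      (w ∉ Finset.univ.map (finalEmb C) ∨ w = finalEmb C ⟨1, hN⟩) := by
    intro w
    have hK : stride (n + m) ≤ stride (n + m) * (finalStage C + 1) := Nat.le_mul_of_pos_right _ (by omega)
    rw [mem_map_finalEmb_iff C hN, Fin.ext_iff, finalEmb_val]
    simp only [finalTgt, one_ne_zero, if_false, if_true]
    generalize stride (n + m) * (finalStage C + 1) = K at hK hpl ⊢
    omega
  constructor
  · intro h
    refine ⟨fun w hw => h w ((hcond w).2 (Or.inl (Finset.mem_sdiff.1 hw).2)), h _ ((hcond _).2 (Or.inr rfl))⟩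
  · rintro ⟨h1, h2⟩ w hw
    rcases (hcond w).1 hw with hw | rfl
    · exact h1 w (Finset.mem_sdiff.2 ⟨Finset.mem_univ _, hw⟩)
    · exact h2

/-- The output wire `n`. [cite: BremnerJozsaShepherdPRSA2011, Def. 3 (single-line output register)] -/
def outWire : Fin (width C) := ⟨n, by have := n_succ_lt_width C; omega⟩

/-- The output wire is the final wire of qubit `0`. [folklore] -/
theorem outWire_eq (hN : 2 ≤ n + m) : outWire C = finalEmb C ⟨0, by omega⟩ := by
  rw [finalEmb_zero C hN]; rfl

/-- **The output state of the compiled IQP circuit** on `|x 0…0⟩`: `H^{⊗W} · U_{gadget} · H^{⊗W} |x 0…0⟩`.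
[cite: BremnerJozsaShepherdPRSA2011, §2.3 and Thm. 1] -/
abbrev gadgetState (x : QReg n) : QReg (width C) → ℂ := iqpUnitary (gadgetCircuit C) *ᵥ basisState (inputReg C x)

/-- The output state through the phase of the compiled gate list. [folklore] -/
theorem gadgetState_eq (x : QReg n) :
    gadgetState C x = hGateAll (width C) *ᵥ (diagonal (listPhase (gadgetGates C)) *ᵥ initState C x) := by
  rw [gadgetState, iqpUnitary, mat_gadgetCircuit, ← mulVec_mulVec, ← mulVec_mulVec]

/-- **The end of the invariant.** If the spent wires `S` (disjoint from the final wires) reach the logical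
state `φ` on the final embedding, then after the final Hadamard layer, post-selecting `0…0` on `S` and
on the never-touched wires `R` leaves `(√2)^{|R|} H^{⊗N} φ` embedded (the fresh wires collapse to `|0⟩`).
[cite: BremnerJozsaShepherdPRSA2011, Thm. 1 (proof)] -/
theorem final_projection {V d : QReg (width C) → ℂ} {S : Finset (Fin (width C))} {φ : QReg (n + m) → ℂ}
    (hR : Reaches C V d S (finalEmb C) φ) (hfS : ∀ j, finalEmb C j ∉ S) :
    zeroProj (S ∪ (Finset.univ \ (S ∪ Finset.univ.map (finalEmb C)))) *ᵥ (hGateAll (width C) *ᵥ (diagonal d *ᵥ V)) =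
      embedState (finalEmb C) (S ∪ (Finset.univ \ (S ∪ Finset.univ.map (finalEmb C))))
        (((Real.sqrt 2 : ℂ) ^ (Finset.univ \ (S ∪ Finset.univ.map (finalEmb C))).card) • (hGateAll (n + m) *ᵥ φ)) := by
  set F := Finset.univ.map (finalEmb C) with hF
  set R := Finset.univ \ (S ∪ F) with hRdef
  have hSF : Disjoint S F := by
    rw [Finset.disjoint_right]; intro w hw hwS
    obtain ⟨j, -, rfl⟩ := Finset.mem_map.1 hw
    exact hfS j hwS
  have hRS : Disjoint R S := by
    rw [Finset.disjoint_left]; intro w hw hwS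
    exact (Finset.mem_sdiff.1 hw).2 (Finset.mem_union_left _ hwS)
  have hRF : Disjoint R F := by
    rw [Finset.disjoint_left]; intro w hw hwF
    exact (Finset.mem_sdiff.1 hw).2 (Finset.mem_union_right _ hwF)
  have huniv : (Finset.univ : Finset (Fin (width C))) = (R ∪ F) ∪ S := by
    ext w
    simp only [Finset.mem_univ, Finset.mem_union, hRdef, Finset.mem_sdiff, true_and, not_or, true_iff]
    tauto
  have hR' : zeroProj S *ᵥ (hLayerMatrix S *ᵥ (diagonal d *ᵥ V)) = embedState (finalEmb C) S φ := hR
  rw [← hLayerMatrix_univ, huniv, hLayerMatrix_union (Finset.disjoint_union_left.2 ⟨hRS, hSF.symm⟩),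
    hLayerMatrix_union hRF, zeroProj_union]
  simp only [← mulVec_mulVec]
  rw [zeroProj_mulVec_comm S R, zeroProj_mulVec_hLayerMatrix_mulVec hRS.symm, zeroProj_mulVec_hLayerMatrix_mulVec hSF,
    hR', hF, hLayerMatrix_map_mulVec_embedState (finalEmb C) hfS,
    hLayerMatrix_fresh_mulVec_embedState (finalEmb C) R hRS (fun j h => Finset.disjoint_left.1 hRF h
      (Finset.mem_map_of_mem _ (Finset.mem_univ j))),
    zeroProj_mulVec_embedState, Finset.union_assoc, Finset.union_idempotent]

/-- Spent wires and never-touched wires together are all the non-final wires. [folklore] -/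
theorem spent_union_rest {S : Finset (Fin (width C))} (hfS : ∀ j, finalEmb C j ∉ S) :
    S ∪ (Finset.univ \ (S ∪ Finset.univ.map (finalEmb C))) = Finset.univ \ Finset.univ.map (finalEmb C) := by
  ext w
  simp only [Finset.mem_union, Finset.mem_sdiff, Finset.mem_univ, true_and, not_or]
  constructor
  · rintro (hw | ⟨-, hw⟩)
    · intro hF; obtain ⟨j, -, rfl⟩ := Finset.mem_map.1 hF; exact hfS j hw
    · exact hw
  · intro hw; by_cases h : w ∈ S
    · exact Or.inl h
    · exact Or.inr ⟨h, hw⟩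

/-- **`X` on a wire flips the bit read.** [cite: NielsenChuang2010, §1.3.1] -/
theorem placeGate_pauliX_mulVec_apply {N : ℕ} (i : Fin N) (u : QReg N → ℂ) (y : QReg N) :
    (placeGate (wireEmb i) pauliX *ᵥ u) y = u (Function.update y i (!y i)) := by
  rw [Matrix.mulVec, dotProduct, Finset.sum_eq_single (Function.update y i (!y i))]
  · rw [placeGate_apply, if_pos]
    · simp [pauliX, Function.comp_def]
    · intro l hl
      rw [range_wireEmb, Set.mem_singleton_iff] at hl
      rw [Function.update_of_ne hl]
  · intro w _ hw
    rw [placeGate_apply]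
    split_ifs with hagree
    · have hwi : w i = y i := by
        by_contra hne
        apply hw
        funext l
        by_cases hl : l = i
        · subst hl
          rw [Function.update_self]
          cases hy : y l <;> cases hw' : w l <;> simp_all
        · rw [Function.update_of_ne hl]
          exact (hagree l (by rw [range_wireEmb, Set.mem_singleton_iff]; exact hl)).symm
      simp [pauliX, hwi]
    · rw [zero_mul]
  · intro h; exact absurd (Finset.mem_univ _) h

-- `flipEquiv`/`flipAt` (flipping one bit, as an equivalence of labels) come from `HadamardGadget.lean`;
-- `‖ω‖ = 1` is `BoykinEtAl.norm_omega` (BoykinGates.lean).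

/-- `(√2^r (1/√2)^{r+q})² = 2^{-q}`. [folklore] -/
theorem const_identity (r q : ℕ) : (Real.sqrt 2 ^ r * (Real.sqrt 2)⁻¹ ^ (r + q)) ^ 2 = ((2 : ℝ) ^ q)⁻¹ := by
  have hs : Real.sqrt 2 ≠ 0 := (Real.sqrt_pos.2 (by norm_num)).ne'
  rw [pow_add, ← mul_assoc, ← mul_pow, mul_inv_cancel₀ hs, one_pow, one_mul, ← pow_mul, mul_comm, pow_mul, inv_pow,
    Real.sq_sqrt (by norm_num : (0:ℝ) ≤ 2), inv_pow]

/-- **The constant of the simulation**: `2^{-N s_f}` — a factor `1/2` for each of the `N · s_f`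
Hadamard gadgets (the probability of its post-selection). [cite: BremnerJozsaShepherdPRSA2011, Thm. 1 (proof)] -/
def gadgetConst : ℝ := ((2 : ℝ) ^ ((n + m) * finalStage C))⁻¹

/-- The constant is positive. [folklore] -/
theorem gadgetConst_pos : 0 < gadgetConst C := by
  unfold gadgetConst; positivity

/-- **Simulation theorem (BJS Theorem 1, proof).** For an oracle-free Clifford+T circuit `C` on
`N = n + m ≥ 2` wires and every `b`, the Born weight, in the output state of the compiled IQP circuit on
`|x 0…0⟩`, of the event "the input wires and the post-selection block read `0…0` and the output wire `n`
reads `b`" is `2^{-N s_f}` times the Born weight, in `C |x 0^m⟩`, of "wire `1` reads `1` and wire `0`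
reads `b`": the compiled post-selected IQP circuit has the same output conditional probabilities as the
post-selected circuit `C` (output wire `0`, post-selection wire `1` on the value `1`).
[cite: BremnerJozsaShepherdPRSA2011, Thm. 1 (proof, p. 7)] -/
theorem gadget_eventSum_eq (hC : C.IsOracleFree) (hN : 2 ≤ n + m) (x : QReg n) (b : Bool) :
    (∑ z : QReg (width C), if (PostZero C z ∧ z (outWire C) = b) then ‖gadgetState C x z‖ ^ 2 else 0) =
      gadgetConst C * ∑ y : QReg (n + m),
        if (y ⟨1, hN⟩ = true ∧ y ⟨0, by omega⟩ = b) then ‖((C.mat *ᵥ basisState (padInput x m)) y)‖ ^ 2 else 0 := by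
  classical
  obtain ⟨S, hlow, hcard, hRall⟩ := reaches_gadget C hN
  have hR := hRall x
  have hfS : ∀ j, finalEmb C j ∉ S := finalEmb_not_mem_of_low C hlow
  set F := Finset.univ.map (finalEmb C) with hF
  set R := Finset.univ \ (S ∪ F) with hRdef
  set T := Finset.univ \ F with hT
  have hST : S ∪ R = T := spent_union_rest C hfS
  -- the logical state at the end
  set c : ℂ := ((Real.sqrt 2 : ℂ)⁻¹) ^ (width C - (n + m)) with hc
  set u : QReg (n + m) → ℂ := C.mat *ᵥ basisState (padInput x m) with hu
  obtain ⟨gs⟩ := C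
  have hML : microListSem (microList ⟨gs⟩) (c • basisState (padInput x m)) = (c * omega ^ omegaCountList gs) • u := by
    rw [microListSem_smul, microListSem_microList hC, smul_smul, hu]
  set φ' : QReg (n + m) → ℂ := ((Real.sqrt 2 : ℂ) ^ R.card) • (hGateAll (n + m) *ᵥ fun y =>
    zPh hN y * (hGateAll (n + m) *ᵥ microListSem (microList ⟨gs⟩) (c • basisState (padInput x m))) y) with hφ'
  have hproj : zeroProj T *ᵥ gadgetState ⟨gs⟩ x = embedState (finalEmb ⟨gs⟩) T φ' := by
    rw [gadgetState_eq, ← hST]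
    exact final_projection ⟨gs⟩ hR hfS
  -- `φ' = κ • X₁ u`
  set κ : ℂ := (Real.sqrt 2 : ℂ) ^ R.card * (c * omega ^ omegaCountList gs) with hκ
  have hφ'eq : φ' = κ • (placeGate (wireEmb ⟨1, hN⟩) pauliX *ᵥ u) := by
    have hdiag : ∀ v : QReg (n + m) → ℂ, (fun y => zPh hN y * v y) = diagonal (zPh hN) *ᵥ v := by
      intro v; funext y; rw [mulVec_diagonal]
    have hZ : diagonal (zPh hN) = placeGate (wireEmb ⟨1, hN⟩) pauliZ := by
      rw [pauliZ_eq_diagonal, placeGate_diagonal]; rfl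
    rw [hφ', hML, hdiag, hZ, mulVec_mulVec, mulVec_mulVec, hZh_eq, mulVec_smul, smul_smul]
  -- step 1: the event in terms of `T` and the final embedding
  have hev : ∀ z : QReg (width ⟨gs⟩), (PostZero ⟨gs⟩ z ∧ z (outWire ⟨gs⟩) = b) ↔
      (ZeroOn T z ∧ ((z ∘ finalEmb ⟨gs⟩) ⟨1, hN⟩ = false ∧ (z ∘ finalEmb ⟨gs⟩) ⟨0, by omega⟩ = b)) := by
    intro z; rw [postZero_iff ⟨gs⟩ hN, outWire_eq ⟨gs⟩ hN, and_assoc]; rfl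
  have hstep1 : (∑ z : QReg (width ⟨gs⟩), if (PostZero ⟨gs⟩ z ∧ z (outWire ⟨gs⟩) = b) then ‖gadgetState ⟨gs⟩ x z‖ ^ 2 else 0) =
      ∑ z : QReg (width ⟨gs⟩), if (ZeroOn T z ∧ ((z ∘ finalEmb ⟨gs⟩) ⟨1, hN⟩ = false ∧ (z ∘ finalEmb ⟨gs⟩) ⟨0, by omega⟩ = b))
        then ‖embedState (finalEmb ⟨gs⟩) T φ' z‖ ^ 2 else 0 := by
    refine Finset.sum_congr rfl fun z _ => ?_
    simp only [hev]
    by_cases hz : ZeroOn T z ∧ ((z ∘ finalEmb ⟨gs⟩) ⟨1, hN⟩ = false ∧ (z ∘ finalEmb ⟨gs⟩) ⟨0, by omega⟩ = b)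
    · rw [if_pos hz, if_pos hz, ← hproj, zeroProj_mulVec_apply, if_pos hz.1]
    · rw [if_neg hz, if_neg hz]
  -- step 2: read out over the logical register
  have hstep2 := sum_ite_normSq_embedState (finalEmb ⟨gs⟩) (S := T)
    (fun w hw => Finset.mem_sdiff.2 ⟨Finset.mem_univ _, fun h => hw (by obtain ⟨j, -, rfl⟩ := Finset.mem_map.1 h; exact ⟨j, rfl⟩)⟩)
    (fun j h => (Finset.mem_sdiff.1 h).2 (Finset.mem_map_of_mem _ (Finset.mem_univ j)))
    (fun y : QReg (n + m) => y ⟨1, hN⟩ = false ∧ y ⟨0, by omega⟩ = b) φ'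
  rw [hstep1, hstep2, hφ'eq]
  -- step 3: the flip of bit `1`
  have hstep3 : (∑ y : QReg (n + m), if (y ⟨1, hN⟩ = false ∧ y ⟨0, by omega⟩ = b) then
      ‖(κ • (placeGate (wireEmb ⟨1, hN⟩) pauliX *ᵥ u)) y‖ ^ 2 else 0) =
      ‖κ‖ ^ 2 * ∑ y : QReg (n + m), if (y ⟨1, hN⟩ = true ∧ y ⟨0, by omega⟩ = b) then ‖u y‖ ^ 2 else 0 := by
    rw [Finset.mul_sum]
    refine Fintype.sum_equiv (flipEquiv ⟨1, hN⟩) _ _ fun y => ?_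
    simp only [Pi.smul_apply, smul_eq_mul, norm_mul, mul_pow, placeGate_pauliX_mulVec_apply]
    have h1 : (flipEquiv ⟨1, hN⟩ y) ⟨1, hN⟩ = !y ⟨1, hN⟩ := flipAt_apply_self ⟨1, hN⟩ y
    have h0 : (flipEquiv ⟨1, hN⟩ y) ⟨0, by omega⟩ = y ⟨0, by omega⟩ :=
      flipAt_apply_of_ne ⟨1, hN⟩ y (w := ⟨0, by omega⟩) (by simp [Fin.ext_iff])
    rw [h1, h0, show (Function.update y ⟨1, hN⟩ (!y ⟨1, hN⟩)) = flipEquiv ⟨1, hN⟩ y from rfl]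
    by_cases hy : y ⟨1, hN⟩ = false <;> by_cases hy0 : y ⟨0, by omega⟩ = b <;> simp [hy, hy0]
  rw [hstep3]
  -- step 4: the constant
  congr 1
  have hRcard : R.card + (n + m) * finalStage ⟨gs⟩ = width (⟨gs⟩ : QCircuit cliffordT (n + m)) - (n + m) := by
    have hSF : Disjoint S F := by
      rw [Finset.disjoint_right]; intro w hw hwS
      obtain ⟨j, -, rfl⟩ := Finset.mem_map.1 hw
      exact hfS j hwS
    have h1 : R.card + (S ∪ F).card = Fintype.card (Fin (width (⟨gs⟩ : QCircuit cliffordT (n + m)))) := by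
      rw [hRdef, ← Finset.card_univ, Finset.card_sdiff_add_card_eq_card (Finset.subset_univ _)]
    rw [Fintype.card_fin, Finset.card_union_of_disjoint hSF, hF, Finset.card_map, Finset.card_univ, Fintype.card_fin,
      hcard] at h1
    have h2 : width (⟨gs⟩ : QCircuit cliffordT (n + m)) = stride (n + m) * (finalStage ⟨gs⟩ + 1) + (n + m) :=
      width_eq n m ⟨gs⟩
    have h3 : (n + m) * finalStage (⟨gs⟩ : QCircuit cliffordT (n + m)) ≤ stride (n + m) * finalStage ⟨gs⟩ :=
      Nat.mul_le_mul_right _ (lt_stride' _).le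
    have h4 : stride (n + m) * finalStage (⟨gs⟩ : QCircuit cliffordT (n + m)) ≤ stride (n + m) * (finalStage ⟨gs⟩ + 1) :=
      Nat.mul_le_mul_left _ (Nat.le_succ _)
    omega
  have hnorm : ‖κ‖ = Real.sqrt 2 ^ R.card * (Real.sqrt 2)⁻¹ ^ (width (⟨gs⟩ : QCircuit cliffordT (n + m)) - (n + m)) := by
    rw [hκ, hc, norm_mul, norm_mul, norm_pow, norm_pow, norm_pow, BoykinEtAl.norm_omega, one_pow, mul_one, norm_inv,
      Complex.norm_real, Real.norm_of_nonneg (Real.sqrt_nonneg 2)]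
  rw [hnorm, ← hRcard, gadgetConst]
  exact const_identity _ _

end readout

end HGadget.Hop

end Literature.Computability.QuantumComplexity
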